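import Mathlib.Analysis.SpecialFunctions.Gaussian.FourierTransform
import Mathlib.MeasureTheory.Group.Prod
import Mathlib.MeasureTheory.Integral.Prod
import HarnessLib

/-!
# A Gaussian mean-value inequality for Fourier integrals: `∫ e^{-b(v-c)²} |Φ_g(v)|² dv ≤ 2π ‖g‖₂²`

Topic `Literature/Analysis/Fourier`. Everything in this file is PROVED (theorems only).

For `g ∈ L¹(ℝ) ∩ L²(ℝ)` put `Φ_g(v) = ∫ g(t) e^{itv} dt` (the unnormalised Fourier integral). By
Plancherel `∫ |Φ_g|² = 2π ∫ |g|²`; this file proves the elementary weighted substitute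

  `∫ e^{-b(v - c)²} |Φ_g(v)|² dv ≤ 2π ∫ |g(t)|² dt`   (`b > 0`, `c ∈ ℝ`),

(`integral_gaussian_mul_norm_sq_phi_le`) which needs neither the `L²` theory of the Fourier
transform nor density arguments: expanding `|Φ_g|² = Φ_g Φ̄_g` and integrating in `v` first
(Fubini, everything absolutely convergent because `g ∈ L¹` and the Gaussian is integrable) gives
`∫ e^{-b(v-c)²}|Φ_g(v)|² dv = ∬ g(t) ḡ(t') K(t − t') dt dt'` with the Gaussian transform
`K(τ) = ∫ e^{-b(v-c)²} e^{iτv} dv`, `|K(τ)| = √(π/b) e^{-τ²/(4b)}` (Mathlib's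
`integral_cexp_quadratic`), `∫ |K| = 2π` independently of `b`; and
`|g(t)ḡ(t')| ≤ (|g(t)|² + |g(t')|²)/2` with the shear invariance of Lebesgue measure on `ℝ²`
bounds the double integral by `‖K‖₁ ‖g‖₂² = 2π ‖g‖₂²`. (This is the first step of the standard
proof of Plancherel's theorem through an approximate identity, e.g. Rudin, *Real and Complex
Analysis*, 9.13, or Montgomery–Vaughan, *Multiplicative Number Theory I*, §5.1 around (5.25);
the point here is that the width `b` is free, so a single wide Gaussian window costs nothing.)

Main statements: `Literature.Analysis.Fourier.GaussianMeanValue.phi`,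
`Literature.Analysis.Fourier.GaussianMeanValue.gaussK`, `norm_gaussK`, `integral_norm_gaussK`,
`integral_gaussian_mul_phi_mul_conj_eq` (the Fubini identity),
`integral_gaussian_mul_norm_sq_phi_le` (the inequality), `integrable_gaussian_mul_norm_sq_phi`.

## References

* W. Rudin, *Real and Complex Analysis*, 3rd ed., McGraw–Hill 1987, Thm. 9.13 (proof).
* H. L. Montgomery, R. C. Vaughan, *Multiplicative Number Theory I. Classical Theory*, CUP 2007,
  §5.1 (Plancherel for Dirichlet series, (5.25)) (`MontgomeryVaughan2007`).
-/

noncomputable section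

open Complex MeasureTheory Real Set Filter Topology
open scoped ComplexConjugate

namespace Literature.Analysis.Fourier.GaussianMeanValue

/-! ### The Fourier integral `Φ_g` and the character `e^{ix}` -/

/-- The unnormalised Fourier integral `Φ_g(v) = ∫ g(t) e^{itv} dt`. [folklore] -/
def phi (g : ℝ → ℂ) (v : ℝ) : ℂ := ∫ t, g t * cexp (I * t * v)

/-- `‖e^{ix}‖ = 1` for real `x`. [folklore] -/
theorem norm_cexp_I_mul (x : ℝ) : ‖cexp (I * x)‖ = 1 := by
  rw [mul_comm, Complex.norm_exp_ofReal_mul_I]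

/-- `‖e^{itv}‖ = 1`. [folklore] -/
theorem norm_cexp_I_mul_mul (t v : ℝ) : ‖cexp (I * t * v)‖ = 1 := by
  rw [show I * (t : ℂ) * v = I * ((t * v : ℝ) : ℂ) by push_cast; ring, norm_cexp_I_mul]

/-- `‖e^{-itv}‖ = 1`. [folklore] -/
theorem norm_cexp_neg_I_mul_mul (t v : ℝ) : ‖cexp (-(I * t * v))‖ = 1 := by
  rw [show -(I * (t : ℂ) * v) = I * ((-(t * v) : ℝ) : ℂ) by push_cast; ring, norm_cexp_I_mul]

/-- `‖Φ_g(v)‖ ≤ ‖g‖₁`. [folklore] -/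
theorem norm_phi_le (g : ℝ → ℂ) (v : ℝ) : ‖phi g v‖ ≤ ∫ t, ‖g t‖ := by
  refine (norm_integral_le_integral_norm _).trans (le_of_eq (integral_congr_ae (ae_of_all _ fun t ↦ ?_)))
  simp only [norm_mul, norm_cexp_I_mul_mul, mul_one]

/-- `Φ_g` is continuous for `g ∈ L¹` (dominated convergence). [folklore] -/
theorem continuous_phi {g : ℝ → ℂ} (hg : Integrable g) : Continuous (phi g) := by
  show Continuous fun v : ℝ ↦ ∫ t, g t * cexp (I * t * v)
  refine continuous_of_dominated (F := fun (v : ℝ) (t : ℝ) ↦ g t * cexp (I * t * v)) (bound := fun t ↦ ‖g t‖)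
    (fun v ↦ ?_) (fun v ↦ ae_of_all _ fun t ↦ ?_) hg.norm (ae_of_all _ fun t ↦ ?_)
  · exact hg.aestronglyMeasurable.mul (Continuous.aestronglyMeasurable (by fun_prop))
  · rw [norm_mul, norm_cexp_I_mul_mul, mul_one]
  · fun_prop

/-- `Φ_g` is bounded and measurable, hence `v ↦ e^{-b(v-c)²}‖Φ_g(v)‖²` is integrable (`b > 0`). [folklore] -/
theorem integrable_gaussian_mul_norm_sq_phi {g : ℝ → ℂ} (hg : Integrable g) {b : ℝ} (hb : 0 < b)
    (c : ℝ) : Integrable fun v : ℝ ↦ Real.exp (-b * (v - c) ^ 2) * ‖phi g v‖ ^ 2 := by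
  have hW : Integrable fun v : ℝ ↦ Real.exp (-b * (v - c) ^ 2) :=
    (integrable_exp_neg_mul_sq hb).comp_sub_right c
  refine hW.mul_of_top_left ?_
  refine memLp_top_of_bound ((continuous_phi hg).norm.pow 2).aestronglyMeasurable ((∫ t, ‖g t‖) ^ 2)
    (ae_of_all _ fun v ↦ ?_)
  rw [Real.norm_eq_abs, abs_of_nonneg (by positivity)]
  exact pow_le_pow_left₀ (norm_nonneg _) (norm_phi_le g v) 2

/-! ### The Gaussian transform `K(τ) = ∫ e^{-b(v-c)²} e^{iτv} dv` -/

/-- The Gaussian transform `K_{b,c}(τ) = ∫ e^{-b(v - c)²} e^{iτv} dv`. [folklore] -/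
def gaussK (b c τ : ℝ) : ℂ := ∫ v, (Real.exp (-b * (v - c) ^ 2) : ℂ) * cexp (I * τ * v)

/-- **Evaluation**: `K_{b,c}(τ) = (π/b)^{1/2} exp(−bc² + (2bc + iτ)²/(4b))` (complete the square;
Mathlib's `integral_cexp_quadratic`). [folklore] -/
theorem gaussK_eq {b : ℝ} (hb : 0 < b) (c τ : ℝ) :
    gaussK b c τ = ((π / b : ℝ) : ℂ) ^ (1 / 2 : ℂ) *
      cexp (-(b : ℂ) * c ^ 2 - (2 * b * c + I * τ) ^ 2 / (4 * (-(b : ℂ)))) := by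
  have hre : (-(b : ℂ)).re < 0 := by simpa using hb
  have h := integral_cexp_quadratic hre (2 * b * c + I * τ) (-(b : ℂ) * c ^ 2)
  have hint : ∀ v : ℝ, (Real.exp (-b * (v - c) ^ 2) : ℂ) * cexp (I * τ * v) =
      cexp (-(b : ℂ) * v ^ 2 + (2 * b * c + I * τ) * v + -(b : ℂ) * c ^ 2) := by
    intro v
    rw [Complex.ofReal_exp, ← Complex.exp_add]
    congr 1
    push_cast
    ring
  rw [gaussK, integral_congr_ae (ae_of_all _ hint), h, neg_neg,
    show (π : ℂ) / b = ((π / b : ℝ) : ℂ) by push_cast; rfl]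

/-- **Size**: `‖K_{b,c}(τ)‖ = √(π/b) e^{-τ²/(4b)}`. [folklore] -/
theorem norm_gaussK {b : ℝ} (hb : 0 < b) (c τ : ℝ) :
    ‖gaussK b c τ‖ = Real.sqrt (π / b) * Real.exp (-τ ^ 2 / (4 * b)) := by
  rw [gaussK_eq hb, norm_mul, Complex.norm_cpow_eq_rpow_re_of_pos (by positivity), Complex.norm_exp]
  congr 1
  · rw [Real.sqrt_eq_rpow]; norm_num
  · congr 1
    have hb0 : (b : ℂ) ≠ 0 := by exact_mod_cast hb.ne'
    have : -(b : ℂ) * c ^ 2 - (2 * b * c + I * τ) ^ 2 / (4 * (-(b : ℂ))) =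
        ((-τ ^ 2 / (4 * b) : ℝ) : ℂ) + ((c * τ : ℝ) : ℂ) * I := by
      push_cast
      field_simp
      ring_nf
      simp only [Complex.I_sq]
      ring
    rw [this, Complex.add_re, Complex.ofReal_re, Complex.re_ofReal_mul, Complex.I_re, mul_zero, add_zero]

/-- **Mass**: `∫ ‖K_{b,c}(τ)‖ dτ = 2π`, independently of `b > 0` and `c`. [folklore] -/
theorem integral_norm_gaussK {b : ℝ} (hb : 0 < b) (c : ℝ) : ∫ τ, ‖gaussK b c τ‖ = 2 * π := by
  simp_rw [norm_gaussK hb]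
  rw [MeasureTheory.integral_const_mul]
  have h : ∫ τ : ℝ, Real.exp (-τ ^ 2 / (4 * b)) = Real.sqrt (π / (1 / (4 * b))) := by
    rw [← integral_gaussian (1 / (4 * b))]
    refine integral_congr_ae (ae_of_all _ fun τ ↦ ?_)
    show Real.exp (-τ ^ 2 / (4 * b)) = Real.exp (-(1 / (4 * b)) * τ ^ 2)
    congr 1
    field_simp
  rw [h, ← Real.sqrt_mul (by positivity)]
  rw [show π / b * (π / (1 / (4 * b))) = (2 * π) ^ 2 by field_simp; ring]
  exact Real.sqrt_sq (by positivity)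

/-- `‖K_{b,c}‖` is integrable. [folklore] -/
theorem integrable_norm_gaussK {b : ℝ} (hb : 0 < b) (c : ℝ) : Integrable fun τ : ℝ ↦ ‖gaussK b c τ‖ := by
  simp_rw [norm_gaussK hb]
  refine (Integrable.const_mul ?_ _)
  have := integrable_exp_neg_mul_sq (b := 1 / (4 * b)) (by positivity)
  refine this.congr (ae_of_all _ fun τ ↦ ?_)
  show Real.exp (-(1 / (4 * b)) * τ ^ 2) = Real.exp (-τ ^ 2 / (4 * b))
  congr 1
  field_simp

/-! ### The Fubini identity `∫ e^{-b(v-c)²} Φ_g Φ̄_g = ∬ g(t) ḡ(t') K(t − t')` -/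

/-- `Φ̄_g(v) = ∫ ḡ(t) e^{-itv} dt`. [folklore] -/
theorem conj_phi (g : ℝ → ℂ) (v : ℝ) : conj (phi g v) = ∫ t, conj (g t) * cexp (-(I * t * v)) := by
  rw [phi, ← integral_conj]
  refine integral_congr_ae (ae_of_all _ fun t ↦ ?_)
  show conj (g t * cexp (I * t * v)) = conj (g t) * cexp (-(I * t * v))
  rw [map_mul, ← Complex.exp_conj, map_mul, map_mul, Complex.conj_I, Complex.conj_ofReal,
    Complex.conj_ofReal]
  ring_nf

/-- Integrability on `ℝ × (ℝ × ℝ)` of the triple integrand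
`H(v, (t, t')) = e^{-b(v-c)²} g(t) e^{itv} ḡ(t') e^{-it'v}`. [folklore] -/
theorem integrable_tripleIntegrand {g : ℝ → ℂ} (hg : Integrable g) {b : ℝ} (hb : 0 < b) (c : ℝ) :
    Integrable (Function.uncurry fun (v : ℝ) (p : ℝ × ℝ) ↦
      (Real.exp (-b * (v - c) ^ 2) : ℂ) * (g p.1 * cexp (I * p.1 * v) * (conj (g p.2) * cexp (-(I * p.2 * v)))))
      ((volume : Measure ℝ).prod (volume : Measure (ℝ × ℝ))) := by
  have hW : Integrable fun v : ℝ ↦ Real.exp (-b * (v - c) ^ 2) :=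
    (integrable_exp_neg_mul_sq hb).comp_sub_right c
  have hgg : Integrable (fun p : ℝ × ℝ ↦ ‖g p.1‖ * ‖g p.2‖) (volume.prod volume) :=
    hg.norm.mul_prod hg.norm
  have hbound : Integrable (fun z : ℝ × (ℝ × ℝ) ↦ Real.exp (-b * (z.1 - c) ^ 2) * (‖g z.2.1‖ * ‖g z.2.2‖))
      ((volume : Measure ℝ).prod (volume : Measure (ℝ × ℝ))) := hW.mul_prod hgg
  refine hbound.mono' ?_ (ae_of_all _ fun z ↦ ?_)
  · -- measurability
    have hg1 : AEStronglyMeasurable (fun z : ℝ × (ℝ × ℝ) ↦ g z.2.1)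
        ((volume : Measure ℝ).prod (volume : Measure (ℝ × ℝ))) :=
      (hg.aestronglyMeasurable.comp_fst (ν := (volume : Measure ℝ))).comp_snd (μ := (volume : Measure ℝ))
    have hg2 : AEStronglyMeasurable (fun z : ℝ × (ℝ × ℝ) ↦ conj (g z.2.2))
        ((volume : Measure ℝ).prod (volume : Measure (ℝ × ℝ))) :=
      (Complex.continuous_conj.comp_aestronglyMeasurable
        (hg.aestronglyMeasurable.comp_snd (μ := (volume : Measure ℝ)))).comp_snd (μ := (volume : Measure ℝ))
    have hc1 : Continuous fun z : ℝ × (ℝ × ℝ) ↦ (Real.exp (-b * (z.1 - c) ^ 2) : ℂ) := by fun_prop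
    have hc2 : Continuous fun z : ℝ × (ℝ × ℝ) ↦ cexp (I * z.2.1 * z.1) := by fun_prop
    have hc3 : Continuous fun z : ℝ × (ℝ × ℝ) ↦ cexp (-(I * z.2.2 * z.1)) := by fun_prop
    exact hc1.aestronglyMeasurable.mul ((hg1.mul hc2.aestronglyMeasurable).mul (hg2.mul hc3.aestronglyMeasurable))
  · obtain ⟨v, t, t'⟩ := z
    simp only [Function.uncurry_apply_pair, norm_mul, Complex.norm_real, Real.norm_eq_abs,
      abs_of_pos (Real.exp_pos _), norm_cexp_I_mul_mul, norm_cexp_neg_I_mul_mul, Complex.norm_conj,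
      mul_one]
    rfl

/-- **The Fubini identity.** For `g ∈ L¹`, `b > 0`:
`∫ e^{-b(v-c)²} Φ_g(v) Φ̄_g(v) dv = ∬ g(t) ḡ(t') K_{b,c}(t − t') dt dt'`. [folklore] -/
theorem integral_gaussian_mul_phi_mul_conj_eq {g : ℝ → ℂ} (hg : Integrable g) {b : ℝ} (hb : 0 < b)
    (c : ℝ) :
    ∫ v, (Real.exp (-b * (v - c) ^ 2) : ℂ) * (phi g v * conj (phi g v)) =
      ∫ p : ℝ × ℝ, g p.1 * conj (g p.2) * gaussK b c (p.1 - p.2) := by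
  -- Step 1: `Φ Φ̄` as an integral over `ℝ × ℝ`
  have hprod : ∀ v : ℝ, phi g v * conj (phi g v) =
      ∫ p : ℝ × ℝ, g p.1 * cexp (I * p.1 * v) * (conj (g p.2) * cexp (-(I * p.2 * v))) := by
    intro v
    rw [conj_phi, phi, ← integral_prod_mul]
    rfl
  -- Step 2: swap the order of integration
  have hswap := integral_integral_swap (integrable_tripleIntegrand hg hb c)
  calc ∫ v, (Real.exp (-b * (v - c) ^ 2) : ℂ) * (phi g v * conj (phi g v))
      = ∫ v, ∫ p : ℝ × ℝ, (Real.exp (-b * (v - c) ^ 2) : ℂ) *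
          (g p.1 * cexp (I * p.1 * v) * (conj (g p.2) * cexp (-(I * p.2 * v)))) := by
        refine integral_congr_ae (ae_of_all _ fun v ↦ ?_)
        dsimp only
        rw [hprod v, ← MeasureTheory.integral_const_mul]
    _ = ∫ p : ℝ × ℝ, ∫ v, (Real.exp (-b * (v - c) ^ 2) : ℂ) *
          (g p.1 * cexp (I * p.1 * v) * (conj (g p.2) * cexp (-(I * p.2 * v)))) := hswap
    _ = ∫ p : ℝ × ℝ, g p.1 * conj (g p.2) * gaussK b c (p.1 - p.2) := by
        refine integral_congr_ae (ae_of_all _ fun p ↦ ?_)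
        dsimp only
        rw [gaussK, ← MeasureTheory.integral_const_mul]
        refine integral_congr_ae (ae_of_all _ fun v ↦ ?_)
        dsimp only
        have : cexp (I * p.1 * v) * cexp (-(I * p.2 * v)) = cexp (I * ((p.1 - p.2 : ℝ) : ℂ) * v) := by
          rw [← Complex.exp_add]; push_cast; ring_nf
        calc (Real.exp (-b * (v - c) ^ 2) : ℂ) * (g p.1 * cexp (I * p.1 * v) * (conj (g p.2) * cexp (-(I * p.2 * v))))
            = g p.1 * conj (g p.2) * ((Real.exp (-b * (v - c) ^ 2) : ℂ) *
                (cexp (I * p.1 * v) * cexp (-(I * p.2 * v)))) := by ring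
          _ = _ := by rw [this]

/-! ### The double-integral bound `∬ |g(t)||g(t')||K(t−t')| ≤ 2π ‖g‖₂²` -/

/-- Change of variables along a measure-preserving self-map of `ℝ × ℝ`. [folklore] -/
theorem integral_comp_measurePreserving {S : ℝ × ℝ → ℝ × ℝ} (hS : MeasurePreserving S volume volume)
    {F : ℝ × ℝ → ℝ} (hF : AEStronglyMeasurable F volume) : ∫ p, F (S p) = ∫ p, F p := by
  have h := integral_map (μ := (volume : Measure (ℝ × ℝ))) hS.measurable.aemeasurable (f := F)
    (by rwa [hS.map_eq])
  rw [hS.map_eq] at h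
  exact h.symm

/-- `∬ ‖g(t)‖² ‖K(t − t')‖ dt dt' = 2π ‖g‖₂²` (shear `(t, t') ↦ (t, t' − t)`), with integrability.
[folklore] -/
theorem integral_norm_sq_fst_mul_norm_gaussK {g : ℝ → ℂ} (hg2 : Integrable fun t ↦ ‖g t‖ ^ 2)
    {b : ℝ} (hb : 0 < b) (c : ℝ) :
    Integrable (fun p : ℝ × ℝ ↦ ‖g p.1‖ ^ 2 * ‖gaussK b c (p.1 - p.2)‖) ∧
    ∫ p : ℝ × ℝ, ‖g p.1‖ ^ 2 * ‖gaussK b c (p.1 - p.2)‖ = (2 * π) * ∫ t, ‖g t‖ ^ 2 := by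
  set F₁ : ℝ × ℝ → ℝ := fun w ↦ ‖g w.1‖ ^ 2 * ‖gaussK b c (-w.2)‖ with hF₁
  have hS := measurePreserving_prod_sub (volume : Measure ℝ) (volume : Measure ℝ)
  have hvol : (volume : Measure (ℝ × ℝ)) = (volume : Measure ℝ).prod volume := rfl
  have hk : Integrable fun s : ℝ ↦ ‖gaussK b c (-s)‖ := (integrable_norm_gaussK hb c).comp_neg
  have hF₁int : Integrable F₁ ((volume : Measure ℝ).prod volume) := hg2.mul_prod hk
  have hcomp : (fun p : ℝ × ℝ ↦ ‖g p.1‖ ^ 2 * ‖gaussK b c (p.1 - p.2)‖) = F₁ ∘ fun z : ℝ × ℝ ↦ (z.1, z.2 - z.1) := by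
    funext p; simp [hF₁, neg_sub]
  refine ⟨?_, ?_⟩
  · rw [hcomp, hvol]
    exact hS.integrable_comp_of_integrable hF₁int
  · rw [hcomp]
    have h1 : ∫ p : ℝ × ℝ, (F₁ ∘ fun z : ℝ × ℝ ↦ (z.1, z.2 - z.1)) p = ∫ p, F₁ p :=
      integral_comp_measurePreserving (by rwa [hvol]) (by rw [hvol]; exact hF₁int.aestronglyMeasurable)
    rw [h1, hvol, hF₁]
    simp only
    rw [integral_prod_mul (fun t : ℝ ↦ ‖g t‖ ^ 2) (fun s : ℝ ↦ ‖gaussK b c (-s)‖), integral_neg_eq_self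
      (fun s : ℝ ↦ ‖gaussK b c s‖), integral_norm_gaussK hb, mul_comm]

/-- `∬ ‖g(t')‖² ‖K(t − t')‖ dt dt' = 2π ‖g‖₂²` (shear `(t, t') ↦ (t − t', t')`), with integrability.
[folklore] -/
theorem integral_norm_sq_snd_mul_norm_gaussK {g : ℝ → ℂ} (hg2 : Integrable fun t ↦ ‖g t‖ ^ 2)
    {b : ℝ} (hb : 0 < b) (c : ℝ) :
    Integrable (fun p : ℝ × ℝ ↦ ‖g p.2‖ ^ 2 * ‖gaussK b c (p.1 - p.2)‖) ∧
    ∫ p : ℝ × ℝ, ‖g p.2‖ ^ 2 * ‖gaussK b c (p.1 - p.2)‖ = (2 * π) * ∫ t, ‖g t‖ ^ 2 := by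
  set F₂ : ℝ × ℝ → ℝ := fun w ↦ ‖gaussK b c w.1‖ * ‖g w.2‖ ^ 2 with hF₂
  have hS := measurePreserving_sub_prod (volume : Measure ℝ) (volume : Measure ℝ)
  have hvol : (volume : Measure (ℝ × ℝ)) = (volume : Measure ℝ).prod volume := rfl
  have hF₂int : Integrable F₂ ((volume : Measure ℝ).prod volume) := (integrable_norm_gaussK hb c).mul_prod hg2
  have hcomp : (fun p : ℝ × ℝ ↦ ‖g p.2‖ ^ 2 * ‖gaussK b c (p.1 - p.2)‖) = F₂ ∘ fun z : ℝ × ℝ ↦ (z.1 - z.2, z.2) := by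
    funext p; simp [hF₂, mul_comm]
  refine ⟨?_, ?_⟩
  · rw [hcomp, hvol]
    exact hS.integrable_comp_of_integrable hF₂int
  · rw [hcomp]
    have h1 : ∫ p : ℝ × ℝ, (F₂ ∘ fun z : ℝ × ℝ ↦ (z.1 - z.2, z.2)) p = ∫ p, F₂ p :=
      integral_comp_measurePreserving (by rwa [hvol]) (by rw [hvol]; exact hF₂int.aestronglyMeasurable)
    rw [h1, hvol, hF₂]
    simp only
    rw [integral_prod_mul (fun s : ℝ ↦ ‖gaussK b c s‖) (fun t : ℝ ↦ ‖g t‖ ^ 2), integral_norm_gaussK hb]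

/-- **The double-integral bound**: `‖∬ g(t) ḡ(t') K(t − t')‖ ≤ 2π ‖g‖₂²`. [folklore] -/
theorem norm_integral_mul_conj_mul_gaussK_le {g : ℝ → ℂ} (hg2 : Integrable fun t ↦ ‖g t‖ ^ 2)
    {b : ℝ} (hb : 0 < b) (c : ℝ) :
    ‖∫ p : ℝ × ℝ, g p.1 * conj (g p.2) * gaussK b c (p.1 - p.2)‖ ≤ (2 * π) * ∫ t, ‖g t‖ ^ 2 := by
  obtain ⟨hI1, hE1⟩ := integral_norm_sq_fst_mul_norm_gaussK hg2 hb c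
  obtain ⟨hI2, hE2⟩ := integral_norm_sq_snd_mul_norm_gaussK hg2 hb c
  calc ‖∫ p : ℝ × ℝ, g p.1 * conj (g p.2) * gaussK b c (p.1 - p.2)‖
      ≤ ∫ p : ℝ × ℝ, ‖g p.1 * conj (g p.2) * gaussK b c (p.1 - p.2)‖ := norm_integral_le_integral_norm _
    _ ≤ ∫ p : ℝ × ℝ, (‖g p.1‖ ^ 2 * ‖gaussK b c (p.1 - p.2)‖ / 2 +
          ‖g p.2‖ ^ 2 * ‖gaussK b c (p.1 - p.2)‖ / 2) := by
        refine integral_mono_of_nonneg (ae_of_all _ fun p ↦ norm_nonneg _)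
          ((hI1.div_const 2).add (hI2.div_const 2)) (ae_of_all _ fun p ↦ ?_)
        simp only [norm_mul, Complex.norm_conj]
        have hk : 0 ≤ ‖gaussK b c (p.1 - p.2)‖ := norm_nonneg _
        nlinarith [sq_nonneg (‖g p.1‖ - ‖g p.2‖), mul_nonneg (sq_nonneg (‖g p.1‖ - ‖g p.2‖)) hk]
    _ = (2 * π) * ∫ t, ‖g t‖ ^ 2 := by
        rw [integral_add (hI1.div_const 2) (hI2.div_const 2), integral_div, integral_div, hE1, hE2]
        ring

/-! ### The inequality -/

/-- **Gaussian mean-value inequality.** For `g ∈ L¹(ℝ) ∩ L²(ℝ)`, `b > 0`, `c ∈ ℝ`: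
`∫ e^{-b(v-c)²} |Φ_g(v)|² dv ≤ 2π ∫ |g(t)|² dt`, `Φ_g(v) = ∫ g(t)e^{itv}dt`.
[cite: MontgomeryVaughan2007, §5.1 (5.25) (proof idea)] -/
theorem integral_gaussian_mul_norm_sq_phi_le {g : ℝ → ℂ} (hg : Integrable g)
    (hg2 : Integrable fun t ↦ ‖g t‖ ^ 2) {b : ℝ} (hb : 0 < b) (c : ℝ) :
    ∫ v, Real.exp (-b * (v - c) ^ 2) * ‖phi g v‖ ^ 2 ≤ (2 * π) * ∫ t, ‖g t‖ ^ 2 := by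
  have hreal : ∀ v : ℝ, (Real.exp (-b * (v - c) ^ 2) : ℂ) * (phi g v * conj (phi g v)) =
      ((Real.exp (-b * (v - c) ^ 2) * ‖phi g v‖ ^ 2 : ℝ) : ℂ) := by
    intro v
    rw [Complex.mul_conj, Complex.normSq_eq_norm_sq]
    push_cast
    ring
  have hint : ∫ v, (Real.exp (-b * (v - c) ^ 2) : ℂ) * (phi g v * conj (phi g v)) =
      ((∫ v, Real.exp (-b * (v - c) ^ 2) * ‖phi g v‖ ^ 2 : ℝ) : ℂ) := by
    rw [integral_congr_ae (ae_of_all _ hreal)]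
    exact integral_complex_ofReal
  have h := norm_integral_mul_conj_mul_gaussK_le hg2 hb c
  rw [← integral_gaussian_mul_phi_mul_conj_eq hg hb c, hint, Complex.norm_real, Real.norm_eq_abs] at h
  exact (le_abs_self _).trans h

end Literature.Analysis.Fourier.GaussianMeanValue

end
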